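import Mathlib
import Summits.RiemannHypothesis.Statement
import Summits.RiemannHypothesis.RiemannHypothesis.Theorems.DeBrangesChainDefs
import Summits.RiemannHypothesis.RiemannHypothesis.Theorems.DeBrangesChainSeparation
import Summits.RiemannHypothesis.RiemannHypothesis.Theorems.DeBrangesChainDoor
import Literature.NumberTheory.LFunctions.SuzukiWeilHilbertSpaceDefs
import Literature.NumberTheory.LFunctions.WeilZeroSum
import HarnessLib
import HarnessLib.Audit

/-!
# RiemannHypothesis / COLUMN 6 (DBR) — the door `ChainDoorV0` MODULO its RH-FREE input D2 (C2 isolation)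

LINE 1 — LABEL: RH-FREE (a re-packaging of the proved door `chainDoorV0_proof`,
`Theorems/DeBrangesChainDoor.lean`, with the separation lemma D2 as an explicit hypothesis, so that the
reserved route «DeBrangesChain» (rh-crit-routes-2; residual `IsolatedV0` RH-EQUIVALENT·PRINTED = aside;
leaf `ChainDoorV0`; cruxes r2 `WeilSumNegOfSeparation` = the statement of
`weilSum_re_neg_of_separation`, r3 `OrderSepWeightSqSummable` = the statement of
`summable_order_mul_sepWeight_sq`; support `DoorModuloInputs : r3 → r2 → ChainDoorV0`) closes each of
its items by a one-line citation the minute it is born. bears_on: B-C/B-P (LADDER-RH §1 COLUMN 6 DBR).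
WHAT THIS IS NOT: no new mathematics beyond `chainDoorV0_proof`; the residual is untouched; nothing
here bears on the truth of RH.

* `chainDoorV0_of_separation hD2 : ChainDoorV0` — the §3.4 argument of [Su25c] with D2 as hypothesis.
* the door itself is then `chainDoorV0_of_separation (fun _ h₀ hoff _ hδ ↦
  weilSum_re_neg_of_separation h₀ hoff hδ)` (checked on the farm; not re-declared — the landed
  `chainDoorV0_proof` of `Theorems/DeBrangesChainDoor.lean` is the theorem of record).
-/

noncomputable section

-- D-0017: `Summit.<S>.<S>.…` is the designed namespace of a single-problem summit.
set_option linter.dupNamespace false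

namespace Summit.RiemannHypothesis.RiemannHypothesis.Theorems.DeBrangesChain

open Literature.NumberTheory.LFunctions MeasureTheory Complex Filter Set
open scoped ComplexConjugate Topology

/-- **The door MODULO its separation input** (for the route's support item `DoorModuloInputs`):
the printed §3.4 argument with D2 "negativity under separation" taken as a HYPOTHESIS `hD2` (the
universally closed statement of `weilSum_re_neg_of_separation`) instead of the tree theorem; everything
else as in `chainDoorV0_proof` (D3 dictionary, additivity `hasHatValue_sub`, `sub_mem_suzukiV`).
RH-FREE. With it, `DoorModuloInputs`-shaped items close by `fun h₁ h₂ ↦ chainDoorV0_of_separation h₂`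
(up to binder order) and the door itself is `chainDoorV0_of_separation (fun ρ₀ h₀ h δ hδ ↦
weilSum_re_neg_of_separation h₀ h hδ)`. -/
theorem chainDoorV0_of_separation
    (hD2 : ∀ ρ₀ : ℂ, ρ₀ ∈ ZetaZeros.riemannZetaNontrivialZeros → ρ₀.re ≠ 1 / 2 → ∀ δ : ℝ, 0 < δ →
      ∃ ε : ℝ, 0 < ε ∧ ∀ c₁ c₂ : ℂ → ℂ,
        c₁ (suzukiZeroParam ρ₀) = 1 →
        c₂ (conj (suzukiZeroParam ρ₀)) = 1 →
        (∀ ρ ∈ ZetaZeros.riemannZetaNontrivialZeros, ρ ≠ ρ₀ →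
          ‖c₁ (suzukiZeroParam ρ)‖ ≤ ε / ‖suzukiZeroParam ρ₀ - suzukiZeroParam ρ‖ ^ (1 + δ)) →
        (∀ ρ ∈ ZetaZeros.riemannZetaNontrivialZeros, ρ ≠ 1 - conj ρ₀ →
          ‖c₂ (suzukiZeroParam ρ)‖ ≤
            ε / ‖suzukiZeroParam (1 - conj ρ₀) - suzukiZeroParam ρ‖ ^ (1 + δ)) →
        ∀ S : ℂ, HasSum (fun ρ : ZetaZeros.riemannZetaNontrivialZeros ↦
            (riemannZetaZeroOrder (ρ : ℂ) : ℂ) *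
              (c₁ (suzukiZeroParam ρ) - c₂ (suzukiZeroParam ρ)) *
              conj (c₁ (conj (suzukiZeroParam ρ)) - c₂ (conj (suzukiZeroParam ρ)))) S →
          S.re < 0) :
    ChainDoorV0 := by
  classical
  rintro ⟨hC1, hC2⟩
  by_contra hRH
  obtain ⟨ρ₀, hρ₀, hoff⟩ := exists_offLine_of_not_riemannHypothesis hRH
  obtain ⟨δ, hδ, hsep⟩ := hC2
  obtain ⟨ε, hε, hneg⟩ := hD2 ρ₀ hρ₀ hoff δ hδ
  have hρ₁ : 1 - conj ρ₀ ∈ ZetaZeros.riemannZetaNontrivialZeros :=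
    ZetaZeros.riemannZetaNontrivialZeros.one_sub_conj_mem hρ₀
  have hne : 1 - conj ρ₀ ≠ ρ₀ := one_sub_conj_ne_self hoff
  obtain ⟨ψ₁, hψ₁V, hψ₁one, hψ₁bd⟩ := hsep ρ₀ hρ₀ ε hε
  obtain ⟨ψ₂, hψ₂V, hψ₂one, hψ₂bd⟩ := hsep (1 - conj ρ₀) hρ₁ ε hε
  choose! v₁ hv₁ hv₁b using hψ₁bd
  choose! v₂ hv₂ hv₂b using hψ₂bd
  -- total value assignments on `ℂ` (only their values on `Γ` matter)
  set c₁ : ℂ → ℂ := Function.update (fun z ↦ v₁ (1 / 2 - I * z)) (suzukiZeroParam ρ₀) 1 with hc₁def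
  set c₂ : ℂ → ℂ := Function.update (fun z ↦ v₂ (1 / 2 - I * z)) (suzukiZeroParam (1 - conj ρ₀)) 1
    with hc₂def
  have hc₁₀ : c₁ (suzukiZeroParam ρ₀) = 1 := by
    simp only [hc₁def, Function.update_self]
  have hc₂₀ : c₂ (suzukiZeroParam (1 - conj ρ₀)) = 1 := by
    simp only [hc₂def, Function.update_self]
  have hc₁ : ∀ ρ : ℂ, ρ ≠ ρ₀ → c₁ (suzukiZeroParam ρ) = v₁ ρ := by
    intro ρ h
    simp only [hc₁def, Function.update_of_ne (suzukiZeroParam_injective.ne h),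
      one_half_sub_I_mul_suzukiZeroParam]
  have hc₂ : ∀ ρ : ℂ, ρ ≠ 1 - conj ρ₀ → c₂ (suzukiZeroParam ρ) = v₂ ρ := by
    intro ρ h
    simp only [hc₂def, Function.update_of_ne (suzukiZeroParam_injective.ne h),
      one_half_sub_I_mul_suzukiZeroParam]
  -- `ψ := ψ₁ − ψ₂ ∈ V(0)` with values `c₁ − c₂`
  have hψV : ψ₁ - ψ₂ ∈ suzukiV 0 := sub_mem_suzukiV hψ₁V hψ₂V
  have hvals : ∀ ρ ∈ ZetaZeros.riemannZetaNontrivialZeros,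
      HasHatValue (ψ₁ - ψ₂) (suzukiZeroParam ρ)
        ((fun z ↦ c₁ z - c₂ z) (suzukiZeroParam ρ)) := by
    intro ρ hρ
    refine hasHatValue_sub ?_ ?_
    · by_cases h : ρ = ρ₀
      · rw [h, hc₁₀]; exact hψ₁one
      · rw [hc₁ ρ h]; exact hv₁ ρ hρ h
    · by_cases h : ρ = 1 - conj ρ₀
      · rw [h, hc₂₀]; exact hψ₂one
      · rw [hc₂ ρ h]; exact hv₂ ρ hρ h
  have hsum := hC1 (ψ₁ - ψ₂) hψV (fun z ↦ c₁ z - c₂ z) hvals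
  have hb1 : ∀ ρ ∈ ZetaZeros.riemannZetaNontrivialZeros, ρ ≠ ρ₀ →
      ‖c₁ (suzukiZeroParam ρ)‖ ≤ ε / ‖suzukiZeroParam ρ₀ - suzukiZeroParam ρ‖ ^ (1 + δ) := by
    intro ρ hρ h; rw [hc₁ ρ h]; exact hv₁b ρ hρ h
  have hb2 : ∀ ρ ∈ ZetaZeros.riemannZetaNontrivialZeros, ρ ≠ 1 - conj ρ₀ →
      ‖c₂ (suzukiZeroParam ρ)‖ ≤
        ε / ‖suzukiZeroParam (1 - conj ρ₀) - suzukiZeroParam ρ‖ ^ (1 + δ) := by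
    intro ρ hρ h; rw [hc₂ ρ h]; exact hv₂b ρ hρ h
  have h2 : c₂ (conj (suzukiZeroParam ρ₀)) = 1 := by
    rw [← suzukiZeroParam_one_sub_conj]; exact hc₂₀
  have hlt := hneg c₁ c₂ hc₁₀ h2 hb1 hb2 _ hsum
  rw [Complex.ofReal_re] at hlt
  nlinarith [norm_nonneg (ψ₁ - ψ₂)]


end Summit.RiemannHypothesis.RiemannHypothesis.Theorems.DeBrangesChain

end
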